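import Summits.PneNP.PneNP.Theorems.ChebyshevTracialDesignCommutative
import HarnessLib

/-!
# Cell pnp-psdrank, route `ChebyshevTracialDesign`: the 3r-DILATION — every tight-orthogonal psd rectangle of dimension `r` is, value for
# value, a tight-orthogonal PROJECTION-valued rectangle of dimension `3r` (crux `TracialDecayExp20`, stmt-PneNP-19878)

Brick 35a (prover g9): the matrix algebra. For contractions `0 ⪯ X, Y ⪯ I_r` given in diagonalised form `X = O·diag(x)·Oᵀ`,
`Y = O'·diag(y)·O'ᵀ` put `C = O·diag(√(x(1−x)))·Oᵀ`, `C' = O'·diag(√(y(1−y)))·O'ᵀ` and, in `3 × 3` blocks of size `r`,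

  `P = [[X, C, 0], [C, 1−X, 0], [0, 0, 0]]`,   `Q = [[Y, 0, C'], [0, 0, 0], [C', 0, 1−Y]]`   (Halmos dilations on DIFFERENT off-blocks).

Then (§2) `P² = P = Pᵀ`, `Q² = Q = Qᵀ` (orthogonal projections), (§3) `tr(P Q) = tr(X Y)` for EVERY pair (only the `(1,1)` blocks meet on
the diagonal), and (§4) `X Y = 0 ⇒ P Q = 0`: the cross blocks `X C'`, `C Y`, `C C'` die because `C` (`C'`) is a spectral function of `X` (`Y`)
vanishing on its kernel (`conjDiag_mul_eq_zero`). §1 is the block calculus (`Matrix.comp` of a `3 × 3` matrix of blocks, re-indexed to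
`Fin (3r)` by `finProdFinEquiv`), §5 packages one pair: `dilation_pair`. The strategy-level normal form (WLOG projections, crux-level
equivalence) is brick 35b `…ProjectionNormalForm`. [cite: BrietDadushPokutta2014, Thm. 6 (§3)] [cite: GriblingDelaatLaurent2019, §5]
Stature: support/instrument (linear algebra). WHAT THIS IS NOT: nothing on the crux's truth, nothing on psd rank, no P-vs-NP content.
-/

set_option linter.dupNamespace false -- `Summit.PneNP.PneNP.…`: summit = sub-problem (D-0017)

noncomputable section

namespace Summit.PneNP.PneNP.Theorems.ChebyshevTracialDesignProjectionDilation

open Finset Matrix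

variable {r : ℕ}

/-! ### §1 Block calculus: `3 × 3` matrices of `r × r` blocks, flattened and re-indexed to `Fin (3r)` -/

/-- The flattening of a `3 × 3` block matrix to a `Fin (3·r)`-indexed matrix. (Spelled out in every statement; no definition.) -/
theorem flat_def (B : Matrix (Fin 3) (Fin 3) (Matrix (Fin r) (Fin r) ℝ)) :
    (Matrix.comp (Fin 3) (Fin 3) (Fin r) (Fin r) ℝ B).submatrix finProdFinEquiv.symm finProdFinEquiv.symm =
      Matrix.reindex finProdFinEquiv finProdFinEquiv (Matrix.comp (Fin 3) (Fin 3) (Fin r) (Fin r) ℝ B) := rfl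

/-- Flattening is multiplicative. -/
theorem flat_mul (A B : Matrix (Fin 3) (Fin 3) (Matrix (Fin r) (Fin r) ℝ)) :
    (Matrix.comp (Fin 3) (Fin 3) (Fin r) (Fin r) ℝ A).submatrix finProdFinEquiv.symm finProdFinEquiv.symm *
        (Matrix.comp (Fin 3) (Fin 3) (Fin r) (Fin r) ℝ B).submatrix finProdFinEquiv.symm finProdFinEquiv.symm =
      (Matrix.comp (Fin 3) (Fin 3) (Fin r) (Fin r) ℝ (A * B)).submatrix finProdFinEquiv.symm finProdFinEquiv.symm := by
  rw [submatrix_mul_equiv, ← compRingEquiv_apply, ← compRingEquiv_apply, ← compRingEquiv_apply, map_mul]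

/-- The trace of a flattened block matrix is the sum of the traces of its diagonal blocks. -/
theorem trace_flat (B : Matrix (Fin 3) (Fin 3) (Matrix (Fin r) (Fin r) ℝ)) :
    ((Matrix.comp (Fin 3) (Fin 3) (Fin r) (Fin r) ℝ B).submatrix finProdFinEquiv.symm finProdFinEquiv.symm).trace =
      (B 0 0).trace + (B 1 1).trace + (B 2 2).trace := by
  have h1 : ((Matrix.comp (Fin 3) (Fin 3) (Fin r) (Fin r) ℝ B).submatrix finProdFinEquiv.symm finProdFinEquiv.symm).trace =
      (Matrix.comp (Fin 3) (Fin 3) (Fin r) (Fin r) ℝ B).trace := by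
    simp only [trace, diag_apply, submatrix_apply]
    exact finProdFinEquiv.symm.sum_comp (fun p => Matrix.comp (Fin 3) (Fin 3) (Fin r) (Fin r) ℝ B p p)
  rw [h1]
  simp only [trace, diag_apply, comp_apply]
  rw [Fintype.sum_prod_type, Fin.sum_univ_three]

/-- Flattening commutes with `1 - ·`. -/
theorem one_sub_flat (B : Matrix (Fin 3) (Fin 3) (Matrix (Fin r) (Fin r) ℝ)) :
    1 - (Matrix.comp (Fin 3) (Fin 3) (Fin r) (Fin r) ℝ B).submatrix finProdFinEquiv.symm finProdFinEquiv.symm =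
      (Matrix.comp (Fin 3) (Fin 3) (Fin r) (Fin r) ℝ (1 - B)).submatrix finProdFinEquiv.symm finProdFinEquiv.symm := by
  rw [← compRingEquiv_apply, ← compRingEquiv_apply, map_sub, map_one]
  change _ = (1 : Matrix (Fin 3 × Fin r) (Fin 3 × Fin r) ℝ).submatrix _ _ - _
  rw [submatrix_one_equiv]
  rfl

/-- The flattening of the zero block matrix is zero. -/
theorem flat_zero : (Matrix.comp (Fin 3) (Fin 3) (Fin r) (Fin r) ℝ 0).submatrix finProdFinEquiv.symm finProdFinEquiv.symm = 0 := by
  rw [← compRingEquiv_apply, map_zero, submatrix_zero]; rfl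

/-- A real symmetric idempotent matrix is positive semidefinite (`A = Aᵀ A`). -/
theorem posSemidef_of_idem {m : Type*} [Fintype m] {A : Matrix m m ℝ} (hs : Aᵀ = A) (hi : A * A = A) : A.PosSemidef := by
  have h := posSemidef_conjTranspose_mul_self A
  rwa [conjTranspose_eq_transpose_of_trivial, hs, hi] at h

/-- … and so is its complement `1 - A`. -/
theorem posSemidef_one_sub_of_idem {m : Type*} [Fintype m] [DecidableEq m] {A : Matrix m m ℝ} (hs : Aᵀ = A) (hi : A * A = A) :
    (1 - A).PosSemidef := by
  refine posSemidef_of_idem (by rw [transpose_sub, transpose_one, hs]) ?_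
  rw [Matrix.sub_mul, Matrix.one_mul, Matrix.mul_sub, Matrix.mul_one, hi, sub_self, sub_zero]

/-- Transpose of a flattened block matrix whose blocks are placed symmetrically and are themselves symmetric. -/
theorem flat_transpose (B : Matrix (Fin 3) (Fin 3) (Matrix (Fin r) (Fin r) ℝ)) (hB : ∀ a b, (B b a)ᵀ = B a b) :
    ((Matrix.comp (Fin 3) (Fin 3) (Fin r) (Fin r) ℝ B).submatrix finProdFinEquiv.symm finProdFinEquiv.symm)ᵀ =
      (Matrix.comp (Fin 3) (Fin 3) (Fin r) (Fin r) ℝ B).submatrix finProdFinEquiv.symm finProdFinEquiv.symm := by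
  rw [transpose_submatrix, transpose_comp]
  congr 1
  refine congrArg _ (Matrix.ext fun a b => ?_)
  rw [map_apply, transpose_apply, hB]

/-! ### §2 The two dilation shapes are projections -/

/-- The cut-side shape `[[X, C, 0], [C, 1−X, 0], [0, 0, 0]]` is idempotent when `C² = X − X²` and `XC = CX`. -/
theorem shapeX_idem {X C : Matrix (Fin r) (Fin r) ℝ} (hC : C * C = X - X * X) (hXC : X * C = C * X) :
    !![X, C, 0; C, 1 - X, 0; 0, 0, (0 : Matrix (Fin r) (Fin r) ℝ)] * !![X, C, 0; C, 1 - X, 0; 0, 0, 0] =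
      !![X, C, 0; C, 1 - X, 0; 0, 0, 0] := by
  have h00 : X * X + C * C = X := by rw [hC]; abel
  have h01 : X * C + C * (1 - X) = C := by rw [Matrix.mul_sub, Matrix.mul_one, hXC]; abel
  have h10 : C * X + (1 - X) * C = C := by rw [Matrix.sub_mul, Matrix.one_mul, hXC]; abel
  have h11 : C * C + (1 - X) * (1 - X) = 1 - X := by
    rw [hC, Matrix.mul_sub, Matrix.sub_mul, Matrix.sub_mul, Matrix.one_mul, Matrix.mul_one, Matrix.one_mul]; abel
  rw [Matrix.mul_fin_three]
  refine Matrix.ext fun a b => ?_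
  fin_cases a <;> fin_cases b <;> simp [h00, h01, h10, h11]

/-- The matching-side shape `[[Y, 0, C'], [0, 0, 0], [C', 0, 1−Y]]` is idempotent when `C'² = Y − Y²` and `YC' = C'Y`. -/
theorem shapeY_idem {Y C : Matrix (Fin r) (Fin r) ℝ} (hC : C * C = Y - Y * Y) (hYC : Y * C = C * Y) :
    !![Y, 0, C; 0, 0, 0; C, 0, (1 - Y : Matrix (Fin r) (Fin r) ℝ)] * !![Y, 0, C; 0, 0, 0; C, 0, 1 - Y] =
      !![Y, 0, C; 0, 0, 0; C, 0, 1 - Y] := by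
  have h00 : Y * Y + C * C = Y := by rw [hC]; abel
  have h02 : Y * C + C * (1 - Y) = C := by rw [Matrix.mul_sub, Matrix.mul_one, hYC]; abel
  have h20 : C * Y + (1 - Y) * C = C := by rw [Matrix.sub_mul, Matrix.one_mul, hYC]; abel
  have h22 : C * C + (1 - Y) * (1 - Y) = 1 - Y := by
    rw [hC, Matrix.mul_sub, Matrix.sub_mul, Matrix.sub_mul, Matrix.one_mul, Matrix.mul_one, Matrix.one_mul]; abel
  rw [Matrix.mul_fin_three]
  refine Matrix.ext fun a b => ?_
  fin_cases a <;> fin_cases b <;> simp [h00, h02, h20, h22]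

/-- `1 −` the cut-side shape, as a block matrix. -/
theorem one_sub_shapeX (X C : Matrix (Fin r) (Fin r) ℝ) :
    (1 : Matrix (Fin 3) (Fin 3) (Matrix (Fin r) (Fin r) ℝ)) - !![X, C, 0; C, 1 - X, 0; 0, 0, 0] =
      !![1 - X, -C, 0; -C, X, 0; 0, 0, 1] := by
  rw [Matrix.one_fin_three]
  refine Matrix.ext fun a b => ?_
  fin_cases a <;> fin_cases b <;> simp

/-! ### §3 The product of the two shapes: trace and vanishing -/

/-- The block product `[[X, C, 0], [C, 1−X, 0], [0,0,0]] · [[Y, 0, C'], [0,0,0], [C', 0, 1−Y]] = [[XY, 0, XC'], [CY, 0, CC'], [0,0,0]]`. -/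
theorem shapeX_mul_shapeY (X C Y C' : Matrix (Fin r) (Fin r) ℝ) :
    !![X, C, 0; C, 1 - X, 0; 0, 0, (0 : Matrix (Fin r) (Fin r) ℝ)] * !![Y, 0, C'; 0, 0, 0; C', 0, 1 - Y] =
      !![X * Y, 0, X * C'; C * Y, 0, C * C'; 0, 0, 0] := by
  rw [Matrix.mul_fin_three]
  refine Matrix.ext fun a b => ?_
  fin_cases a <;> fin_cases b <;> simp

/-- **Trace.** The flattened product has trace `tr(X Y)` — for every pair, tight or not. -/
theorem trace_flat_shapeX_mul_shapeY (X C Y C' : Matrix (Fin r) (Fin r) ℝ) :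
    ((Matrix.comp (Fin 3) (Fin 3) (Fin r) (Fin r) ℝ !![X, C, 0; C, 1 - X, 0; 0, 0, 0]).submatrix finProdFinEquiv.symm
          finProdFinEquiv.symm *
        (Matrix.comp (Fin 3) (Fin 3) (Fin r) (Fin r) ℝ !![Y, 0, C'; 0, 0, 0; C', 0, 1 - Y]).submatrix finProdFinEquiv.symm
          finProdFinEquiv.symm).trace = (X * Y).trace := by
  rw [flat_mul, shapeX_mul_shapeY, trace_flat]
  simp

/-- **Vanishing.** If `X Y = 0`, `X C' = 0`, `C Y = 0` and `C C' = 0`, the flattened product vanishes. -/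
theorem flat_shapeX_mul_shapeY_eq_zero {X C Y C' : Matrix (Fin r) (Fin r) ℝ} (h1 : X * Y = 0) (h2 : X * C' = 0)
    (h3 : C * Y = 0) (h4 : C * C' = 0) :
    (Matrix.comp (Fin 3) (Fin 3) (Fin r) (Fin r) ℝ !![X, C, 0; C, 1 - X, 0; 0, 0, 0]).submatrix finProdFinEquiv.symm
          finProdFinEquiv.symm *
        (Matrix.comp (Fin 3) (Fin 3) (Fin r) (Fin r) ℝ !![Y, 0, C'; 0, 0, 0; C', 0, 1 - Y]).submatrix finProdFinEquiv.symm
          finProdFinEquiv.symm = 0 := by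
  rw [flat_mul, shapeX_mul_shapeY, h1, h2, h3, h4, ← flat_zero (r := r)]
  congr 2
  refine Matrix.ext fun a b => ?_
  fin_cases a <;> fin_cases b <;> simp

/-! ### §4 Spectral functions in a common eigenbasis: products, commutation, and the kernel-vanishing principle -/

/-- `(O diag(a) Oᵀ)(O diag(b) Oᵀ) = O diag(a·b) Oᵀ` for `OᵀO = I`. -/
theorem conjDiag_mul_conjDiag (O : Matrix (Fin r) (Fin r) ℝ) (hO : Oᵀ * O = 1) (a b : Fin r → ℝ) :
    (O * diagonal a * Oᵀ) * (O * diagonal b * Oᵀ) = O * diagonal (fun i => a i * b i) * Oᵀ := by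
  calc (O * diagonal a * Oᵀ) * (O * diagonal b * Oᵀ) = O * diagonal a * (Oᵀ * O) * diagonal b * Oᵀ := by
        simp only [Matrix.mul_assoc]
    _ = O * diagonal (fun i => a i * b i) * Oᵀ := by rw [hO, Matrix.mul_one, Matrix.mul_assoc O, diagonal_mul_diagonal]

/-- `O diag(a) Oᵀ` is symmetric. -/
theorem conjDiag_transpose (O : Matrix (Fin r) (Fin r) ℝ) (a : Fin r → ℝ) : (O * diagonal a * Oᵀ)ᵀ = O * diagonal a * Oᵀ := by
  rw [transpose_mul, transpose_mul, transpose_transpose, diagonal_transpose, Matrix.mul_assoc]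

/-- **Kernel-vanishing principle (left).** If `(O diag(x) Oᵀ) B = 0` and `z` vanishes wherever `x` does, then `(O diag(z) Oᵀ) B = 0`. -/
theorem conjDiag_mul_eq_zero (O : Matrix (Fin r) (Fin r) ℝ) (hO : Oᵀ * O = 1) {x z : Fin r → ℝ} (hz : ∀ i, x i = 0 → z i = 0)
    {B : Matrix (Fin r) (Fin r) ℝ} (h : O * diagonal x * Oᵀ * B = 0) : O * diagonal z * Oᵀ * B = 0 := by
  have h' : diagonal x * (Oᵀ * B) = 0 := by
    have := congrArg (fun M => Oᵀ * M) h
    simpa only [← Matrix.mul_assoc, hO, Matrix.one_mul, Matrix.mul_zero] using this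
  have hz' : diagonal z * (Oᵀ * B) = 0 := by
    ext i j
    have hij := congrFun (congrFun h' i) j
    rw [diagonal_mul, Matrix.zero_apply] at hij ⊢
    rcases mul_eq_zero.1 hij with hx | hN
    · rw [hz i hx, zero_mul]
    · rw [hN, mul_zero]
  calc O * diagonal z * Oᵀ * B = O * (diagonal z * (Oᵀ * B)) := by simp only [Matrix.mul_assoc]
    _ = 0 := by rw [hz', Matrix.mul_zero]

/-- **Kernel-vanishing principle (right).** If `B (O diag(x) Oᵀ) = 0` and `z` vanishes wherever `x` does, then `B (O diag(z) Oᵀ) = 0`. -/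
theorem mul_conjDiag_eq_zero (O : Matrix (Fin r) (Fin r) ℝ) (hO : Oᵀ * O = 1) {x z : Fin r → ℝ} (hz : ∀ i, x i = 0 → z i = 0)
    {B : Matrix (Fin r) (Fin r) ℝ} (h : B * (O * diagonal x * Oᵀ) = 0) : B * (O * diagonal z * Oᵀ) = 0 := by
  have ht : O * diagonal x * Oᵀ * Bᵀ = 0 := by
    have := congrArg transpose h
    rwa [transpose_mul, conjDiag_transpose, transpose_zero] at this
  have := congrArg transpose (conjDiag_mul_eq_zero O hO hz ht)
  rwa [transpose_mul, transpose_transpose, conjDiag_transpose, transpose_zero] at this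

/-- The square-root profile `√(x(1−x))` vanishes wherever `x` does. -/
theorem sqrt_profile_vanish (x : Fin r → ℝ) (i : Fin r) (hx : x i = 0) : Real.sqrt (x i * (1 - x i)) = 0 := by
  rw [hx, zero_mul, Real.sqrt_zero]

/-- `C = O diag(√(x(1−x))) Oᵀ` squares to `X − X²` when `0 ≤ x ≤ 1`. -/
theorem sqrtConj_sq (O : Matrix (Fin r) (Fin r) ℝ) (hO : Oᵀ * O = 1) {x : Fin r → ℝ} (hx : ∀ i, 0 ≤ x i ∧ x i ≤ 1) :
    (O * diagonal (fun i => Real.sqrt (x i * (1 - x i))) * Oᵀ) * (O * diagonal (fun i => Real.sqrt (x i * (1 - x i))) * Oᵀ) =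
      O * diagonal x * Oᵀ - (O * diagonal x * Oᵀ) * (O * diagonal x * Oᵀ) := by
  rw [conjDiag_mul_conjDiag O hO, conjDiag_mul_conjDiag O hO, ← Matrix.sub_mul, ← Matrix.mul_sub, diagonal_sub]
  congr 2
  refine congrArg diagonal (funext fun i => ?_)
  rw [Real.mul_self_sqrt (mul_nonneg (hx i).1 (sub_nonneg.2 (hx i).2))]
  ring

/-- … and commutes with `X`. -/
theorem conjDiag_comm (O : Matrix (Fin r) (Fin r) ℝ) (hO : Oᵀ * O = 1) (a b : Fin r → ℝ) :
    (O * diagonal a * Oᵀ) * (O * diagonal b * Oᵀ) = (O * diagonal b * Oᵀ) * (O * diagonal a * Oᵀ) := by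
  rw [conjDiag_mul_conjDiag O hO, conjDiag_mul_conjDiag O hO]
  congr 2
  exact congrArg diagonal (funext fun i => mul_comm _ _)

/-! ### §5 One pair, packaged -/

/-- **Cut-side dilation is an orthogonal projection.** For `X = O diag(x) Oᵀ` (`OᵀO = I`, `0 ≤ x ≤ 1`), `C = O diag(√(x(1−x))) Oᵀ` and the
flattened shape `P = [[X, C, 0], [C, 1−X, 0], [0,0,0]]` of size `3r`: `P ⪰ 0`, `1 − P ⪰ 0` and `P² = P`.
[cite: BrietDadushPokutta2014, Thm. 6 (§3)] -/
theorem dilationX_proj (O : Matrix (Fin r) (Fin r) ℝ) (hO : Oᵀ * O = 1) {x : Fin r → ℝ} (hx : ∀ i, 0 ≤ x i ∧ x i ≤ 1)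
    {X C : Matrix (Fin r) (Fin r) ℝ} (hX : X = O * diagonal x * Oᵀ) (hC : C = O * diagonal (fun i => Real.sqrt (x i * (1 - x i))) * Oᵀ)
    {P : Matrix (Fin (3 * r)) (Fin (3 * r)) ℝ}
    (hP : P = (Matrix.comp (Fin 3) (Fin 3) (Fin r) (Fin r) ℝ !![X, C, 0; C, 1 - X, 0; 0, 0, 0]).submatrix
      finProdFinEquiv.symm finProdFinEquiv.symm) :
    (P.PosSemidef ∧ (1 - P).PosSemidef) ∧ P * P = P := by
  have hCsq : C * C = X - X * X := by rw [hC, hX]; exact sqrtConj_sq O hO hx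
  have hXC : X * C = C * X := by rw [hC, hX]; exact conjDiag_comm O hO _ _
  have hXs : Xᵀ = X := by rw [hX]; exact conjDiag_transpose O x
  have hCs : Cᵀ = C := by rw [hC]; exact conjDiag_transpose O _
  have hPP : P * P = P := by rw [hP, flat_mul, shapeX_idem hCsq hXC]
  have hPs : Pᵀ = P := by
    rw [hP]
    refine flat_transpose _ fun a b => ?_
    fin_cases a <;> fin_cases b <;> simp [hXs, hCs, transpose_sub, transpose_one]
  exact ⟨⟨posSemidef_of_idem hPs hPP, posSemidef_one_sub_of_idem hPs hPP⟩, hPP⟩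

/-- **Matching-side dilation is an orthogonal projection.** For `Y = O' diag(y) O'ᵀ` (`O'ᵀO' = I`, `0 ≤ y ≤ 1`), `C' = O' diag(√(y(1−y))) O'ᵀ`
and the flattened shape `Q = [[Y, 0, C'], [0,0,0], [C', 0, 1−Y]]` of size `3r`: `Q ⪰ 0`, `1 − Q ⪰ 0` and `Q² = Q`.
[cite: BrietDadushPokutta2014, Thm. 6 (§3)] -/
theorem dilationY_proj (O' : Matrix (Fin r) (Fin r) ℝ) (hO' : O'ᵀ * O' = 1) {y : Fin r → ℝ} (hy : ∀ i, 0 ≤ y i ∧ y i ≤ 1)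
    {Y C' : Matrix (Fin r) (Fin r) ℝ} (hY : Y = O' * diagonal y * O'ᵀ)
    (hC' : C' = O' * diagonal (fun i => Real.sqrt (y i * (1 - y i))) * O'ᵀ) {Q : Matrix (Fin (3 * r)) (Fin (3 * r)) ℝ}
    (hQ : Q = (Matrix.comp (Fin 3) (Fin 3) (Fin r) (Fin r) ℝ !![Y, 0, C'; 0, 0, 0; C', 0, 1 - Y]).submatrix
      finProdFinEquiv.symm finProdFinEquiv.symm) :
    (Q.PosSemidef ∧ (1 - Q).PosSemidef) ∧ Q * Q = Q := by
  have hC'sq : C' * C' = Y - Y * Y := by rw [hC', hY]; exact sqrtConj_sq O' hO' hy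
  have hYC' : Y * C' = C' * Y := by rw [hC', hY]; exact conjDiag_comm O' hO' _ _
  have hYs : Yᵀ = Y := by rw [hY]; exact conjDiag_transpose O' y
  have hC's : C'ᵀ = C' := by rw [hC']; exact conjDiag_transpose O' _
  have hQQ : Q * Q = Q := by rw [hQ, flat_mul, shapeY_idem hC'sq hYC']
  have hQs : Qᵀ = Q := by
    rw [hQ]
    refine flat_transpose _ fun a b => ?_
    fin_cases a <;> fin_cases b <;> simp [hYs, hC's, transpose_sub, transpose_one]
  exact ⟨⟨posSemidef_of_idem hQs hQQ, posSemidef_one_sub_of_idem hQs hQQ⟩, hQQ⟩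

/-- **The dilation of one pair: trace and tightness.** With `P`, `Q` as in `dilationX_proj` / `dilationY_proj`:
`tr(P Q) = tr(X Y)` always, and `X Y = 0 ⇒ P Q = 0`. [cite: BrietDadushPokutta2014, Thm. 6 (§3)] -/
theorem dilation_pair (O O' : Matrix (Fin r) (Fin r) ℝ) (hO : Oᵀ * O = 1) (hO' : O'ᵀ * O' = 1) {x y : Fin r → ℝ}
    {X Y C C' : Matrix (Fin r) (Fin r) ℝ} (hX : X = O * diagonal x * Oᵀ) (hY : Y = O' * diagonal y * O'ᵀ)
    (hC : C = O * diagonal (fun i => Real.sqrt (x i * (1 - x i))) * Oᵀ)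
    (hC' : C' = O' * diagonal (fun i => Real.sqrt (y i * (1 - y i))) * O'ᵀ)
    {P Q : Matrix (Fin (3 * r)) (Fin (3 * r)) ℝ}
    (hP : P = (Matrix.comp (Fin 3) (Fin 3) (Fin r) (Fin r) ℝ !![X, C, 0; C, 1 - X, 0; 0, 0, 0]).submatrix
      finProdFinEquiv.symm finProdFinEquiv.symm)
    (hQ : Q = (Matrix.comp (Fin 3) (Fin 3) (Fin r) (Fin r) ℝ !![Y, 0, C'; 0, 0, 0; C', 0, 1 - Y]).submatrix
      finProdFinEquiv.symm finProdFinEquiv.symm) :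
    (P * Q).trace = (X * Y).trace ∧ (X * Y = 0 → P * Q = 0) := by
  refine ⟨by rw [hP, hQ]; exact trace_flat_shapeX_mul_shapeY X C Y C', fun hXY => ?_⟩
  -- the three cross blocks die on the kernel
  have h2 : X * C' = 0 := by
    rw [hC']; rw [hY] at hXY
    exact mul_conjDiag_eq_zero O' hO' (fun i hi => sqrt_profile_vanish y i hi) hXY
  have h3 : C * Y = 0 := by
    rw [hC]; rw [hX] at hXY
    exact conjDiag_mul_eq_zero O hO (fun i hi => sqrt_profile_vanish x i hi) hXY
  have h4 : C * C' = 0 := by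
    rw [hC]; rw [hX] at h2
    exact conjDiag_mul_eq_zero O hO (fun i hi => sqrt_profile_vanish x i hi) h2
  rw [hP, hQ]; exact flat_shapeX_mul_shapeY_eq_zero hXY h2 h3 h4

end Summit.PneNP.PneNP.Theorems.ChebyshevTracialDesignProjectionDilation

end
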